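import Summits.MatrixMultiplication.MatrixMultiplication.Theorems.AbelianSTPPCensusTECertDefs

/-!
# Certificate checker for `ShapeExclusionTE`: the knapsack rows dominate (completion bound O4)

Cell mm-stpp, route `AbelianSTPPCensus`, crux `ShapeExclusionTE` (stmt-MatrixMultiplication-19759); see the module docstring of
`AbelianSTPPCensusTECertDefs.lean` for the design of the certificate checker.  Support file (no new definitions).

Content: `knapPass` / `knapAdd` (binary splitting) / `addTier` / `rowsDesc` compute rows `row_V` with
`Σ qOf V' ≤ row_V[b]` for every list of candidate shapes of volumes `≤ V` and total weight `Σ (ab+bc+ca) ≤ b ≤ Bmax`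
(`rowsDesc_spec`); completeness of the candidate enumeration `tierTriples` (`mem_tierTriples`).
WHAT THIS IS NOT: no statement about STPP families; arithmetic on shape lists only.
-/

-- single-conjunct summit: the mandated namespace repeats `MatrixMultiplication`.
set_option linter.dupNamespace false

namespace Summit.MatrixMultiplication.MatrixMultiplication.Theorems.TECert

/-! ## Knapsack rows: lemmas -/

/-- A knapsack pass preserves the row length. -/
theorem length_knapPass (row : List ℕ) (kU kq : ℕ) : (knapPass row kU kq).length = row.length := by
  simp only [knapPass, List.length_append, List.length_take, List.length_zipWith, List.length_drop]
  omega

/-- A knapsack pass never decreases a cell. -/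
theorem le_getD_knapPass (row : List ℕ) (kU kq b : ℕ) : row.getD b 0 ≤ (knapPass row kU kq).getD b 0 := by
  simp only [knapPass, List.getD_eq_getElem?_getD]
  by_cases hb : b < row.length
  · by_cases hbk : b < kU
    · rw [List.getElem?_append_left (by simp; omega), List.getElem?_take, if_pos hbk]
    · rw [List.getElem?_append_right (by simp; omega)]
      simp only [List.length_take, List.getElem?_zipWith, List.getElem?_drop]
      have h1 : min kU row.length = kU := by omega
      rw [h1, show kU + (b - kU) = b by omega, List.getElem?_eq_getElem hb,
        List.getElem?_eq_getElem (show b - kU < row.length by omega)]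
      simp
  · rw [List.getElem?_eq_none (by omega)]
    simp

/-- A knapsack pass dominates the shifted cell plus the item value. -/
theorem shift_le_getD_knapPass (row : List ℕ) (kU kq b : ℕ) (hkb : kU ≤ b) (hb : b < row.length) :
    row.getD (b - kU) 0 + kq ≤ (knapPass row kU kq).getD b 0 := by
  simp only [knapPass, List.getD_eq_getElem?_getD]
  rw [List.getElem?_append_right (by simp; omega)]
  simp only [List.length_take, List.getElem?_zipWith, List.getElem?_drop]
  have h1 : min kU row.length = kU := by omega
  rw [h1, show kU + (b - kU) = b by omega, List.getElem?_eq_getElem hb,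
    List.getElem?_eq_getElem (show b - kU < row.length by omega)]
  simp only [Option.getD_some]
  omega

/-- The binary-splitting insertion dominates every multiplicity `m < 2^fuel` of the item `(kU, kq)`. -/
theorem knapAdd_dom (U q : ℕ) (hU : 1 ≤ U) : ∀ (fuel k : ℕ) (row : List ℕ), row.length = Bmax + 1 →
    (knapAdd U q fuel k row).length = Bmax + 1 ∧
    ∀ m b, m < 2 ^ fuel → m * (k * U) ≤ b → b ≤ Bmax →
      row.getD (b - m * (k * U)) 0 + m * (k * q) ≤ (knapAdd U q fuel k row).getD b 0
  | 0, k, row, hlen => by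
    refine ⟨by simpa [knapAdd] using hlen, fun m b hm _ _ => ?_⟩
    have : m = 0 := by simpa using hm
    subst this; simp [knapAdd]
  | fuel + 1, k, row, hlen => by
    by_cases hk : k * U ≤ Bmax
    · have hlen' : (knapPass row (k * U) (k * q)).length = Bmax + 1 := by rw [length_knapPass, hlen]
      obtain ⟨ihlen, ih⟩ := knapAdd_dom U q hU fuel (2 * k) (knapPass row (k * U) (k * q)) hlen'
      have hred : knapAdd U q (fuel + 1) k row = knapAdd U q fuel (2 * k) (knapPass row (k * U) (k * q)) := by
        simp [knapAdd, hU, hk]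
      rw [hred]
      refine ⟨ihlen, fun m b hm hmb hb => ?_⟩
      have h2 : m / 2 < 2 ^ fuel := by
        rw [Nat.pow_succ] at hm; omega
      have key := ih (m / 2) b h2 (by
        have : m / 2 * (2 * k * U) ≤ m * (k * U) := by
          rw [show m / 2 * (2 * k * U) = (m / 2 * 2) * (k * U) by ring]
          exact Nat.mul_le_mul_right _ (Nat.div_mul_le_self m 2)
        omega) hb
      rcases Nat.even_or_odd m with ⟨m', hm'⟩ | ⟨m', hm'⟩
      · -- m = 2 m'
        have hdiv : m / 2 = m' := by omega
        rw [hdiv] at key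
        have e1 : b - m' * (2 * k * U) = b - m * (k * U) := by
          rw [hm']; congr 1; ring
        have e2 : m' * (2 * k * q) = m * (k * q) := by rw [hm']; ring
        rw [e1, e2] at key
        exact le_trans (Nat.add_le_add_right (le_getD_knapPass row (k * U) (k * q) _) _) key
      · -- m = 2 m' + 1
        have hdiv : m / 2 = m' := by omega
        rw [hdiv] at key
        set c := b - m' * (2 * k * U) with hc
        have hmk : m * (k * U) = m' * (2 * k * U) + k * U := by rw [hm']; ring
        have hkc : k * U ≤ c := by omega
        have hcl : c < row.length := by rw [hlen]; omega
        have step := shift_le_getD_knapPass row (k * U) (k * q) c hkc hcl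
        have e1 : c - k * U = b - m * (k * U) := by omega
        have e2 : m * (k * q) = m' * (2 * k * q) + k * q := by rw [hm']; ring
        rw [e1] at step
        rw [e2]
        calc row.getD (b - m * (k * U)) 0 + (m' * (2 * k * q) + k * q)
            = (row.getD (b - m * (k * U)) 0 + k * q) + m' * (2 * k * q) := by ring
          _ ≤ (knapPass row (k * U) (k * q)).getD c 0 + m' * (2 * k * q) := Nat.add_le_add_right step _
          _ ≤ _ := key
    · have hred : knapAdd U q (fuel + 1) k row = row := by simp [knapAdd, hk]
      rw [hred]
      refine ⟨hlen, fun m b _ hmb hb => ?_⟩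
      have hm0 : m = 0 := by
        by_contra h
        have : 1 * (k * U) ≤ m * (k * U) := Nat.mul_le_mul_right _ (Nat.one_le_iff_ne_zero.mpr h)
        omega
      subst hm0; simp

/-- Domination is antitone in the class. -/
theorem Dom.mono {row : List ℕ} {C C' : ℕ × ℕ × ℕ → Prop} (h : Dom row C) (hCC : ∀ t, C' t → C t) : Dom row C' :=
  fun G hG b hb hs => h G (fun t ht => hCC t (hG t ht)) b hb hs

/-- Splitting a list of shapes in `C ∨ new-class` into the count of new-class members and a list in `C`. -/
theorem split_count (C : ℕ × ℕ × ℕ → Prop) (U q : ℕ) :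
    ∀ G : List (ℕ × ℕ × ℕ), (∀ t ∈ G, C t ∨ (qOf (vol t) = q ∧ us t = U)) →
      ∃ (m : ℕ) (G₂ : List (ℕ × ℕ × ℕ)), (∀ t ∈ G₂, C t) ∧ (G.map us).sum = m * U + (G₂.map us).sum ∧
        (G.map fun t => qOf (vol t)).sum = m * q + (G₂.map fun t => qOf (vol t)).sum
  | [], _ => ⟨0, [], by simp, by simp, by simp⟩
  | t :: G, hG => by
    obtain ⟨m, G₂, hG₂, hs, hv⟩ := split_count C U q G (fun t' ht' => hG t' (List.mem_cons_of_mem _ ht'))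
    rcases hG t (List.mem_cons_self) with hC | ⟨hq, hu⟩
    · refine ⟨m, t :: G₂, ?_, ?_, ?_⟩
      · intro t' ht'
        rcases List.mem_cons.mp ht' with rfl | h
        · exact hC
        · exact hG₂ t' h
      · simp [hs]; ring
      · simp [hv]; ring
    · refine ⟨m + 1, G₂, hG₂, ?_, ?_⟩
      · simp [hs, hu]; ring
      · simp [hv, hq]; ring

/-- One item insertion: the new row dominates the old class extended by the item's class. -/
theorem knapAdd_one_dom (U q : ℕ) (hU : 1 ≤ U) (row : List ℕ) (hlen : row.length = Bmax + 1)
    (C : ℕ × ℕ × ℕ → Prop) (hdom : Dom row C) :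
    (knapAdd U q 10 1 row).length = Bmax + 1 ∧
      Dom (knapAdd U q 10 1 row) (fun t => C t ∨ (qOf (vol t) = q ∧ us t = U)) := by
  obtain ⟨hlen', hka⟩ := knapAdd_dom U q hU 10 1 row hlen
  refine ⟨hlen', fun G hG b hb hs => ?_⟩
  obtain ⟨m, G₂, hG₂, hsu, hsv⟩ := split_count C U q G hG
  rw [hsv]
  have hmU : m * U ≤ b := by omega
  have hm : m < 2 ^ 10 := by
    have : m * 1 ≤ m * U := Nat.mul_le_mul_left _ hU
    simp [Bmax] at hb; omega
  have h1 := hdom G₂ hG₂ (b - m * U) (by omega) (by omega)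
  have h2 := hka m b hm (by simpa using hmU) hb
  simp only [one_mul] at h2
  omega

/-- Folding the insertions of a list of weights with a common value. -/
theorem foldl_knapAdd_dom (q : ℕ) : ∀ (Us : List ℕ) (row : List ℕ) (C : ℕ × ℕ × ℕ → Prop),
    (∀ U ∈ Us, 1 ≤ U) → row.length = Bmax + 1 → Dom row C →
      (Us.foldl (fun r U => knapAdd U q 10 1 r) row).length = Bmax + 1 ∧
        Dom (Us.foldl (fun r U => knapAdd U q 10 1 r) row) (fun t => C t ∨ (qOf (vol t) = q ∧ us t ∈ Us))
  | [], row, C, _, hlen, hdom => ⟨by simpa using hlen, by simpa using hdom.mono (fun t h => by simpa using h)⟩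
  | U :: Us, row, C, hUs, hlen, hdom => by
    obtain ⟨hlen₁, hdom₁⟩ := knapAdd_one_dom U q (hUs U (List.mem_cons_self)) row hlen C hdom
    obtain ⟨hlen₂, hdom₂⟩ := foldl_knapAdd_dom q Us _ _ (fun U' h => hUs U' (List.mem_cons_of_mem _ h)) hlen₁ hdom₁
    refine ⟨by simpa using hlen₂, ?_⟩
    simp only [List.foldl_cons]
    refine hdom₂.mono fun t ht => ?_
    rcases ht with h | ⟨hq, hu⟩
    · exact Or.inl (Or.inl h)
    · rcases List.mem_cons.mp hu with h | h
      · exact Or.inl (Or.inr ⟨hq, h⟩)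
      · exact Or.inr ⟨hq, h⟩

/-- `tableOK` unfolded into its seven inequalities. -/
theorem tableOK_iff (M a b c : ℕ) : tableOK M a b c = true ↔
    a * b * c ≤ M ∧ a * (b + c - 1) ≤ M ∧ b * (c + a - 1) ≤ M ∧ c * (a + b - 1) ≤ M ∧
      a * b * c + a ≤ M ∧ a * b * c + b ≤ M ∧ a * b * c + c ≤ M := by
  simp only [tableOK, Nat.beq_eq]
  omega

/-- The table test is monotone in the order. -/
theorem tableOK_mono {M M' a b c : ℕ} (h : tableOK M a b c = true) (hM : M ≤ M') : tableOK M' a b c = true := by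
  rw [tableOK_iff] at *
  omega

/-- Completeness of the candidate enumeration. -/
theorem mem_tierTriples {a b c : ℕ} (ha : 1 ≤ a) (hb : 1 ≤ b) (hc : 1 ≤ c) (h : tableOK 127 a b c = true) :
    (a, b, c) ∈ tierTriples (a * b * c) := by
  have hVa : a * b * c / a = b * c := by
    rw [mul_assoc]; exact Nat.mul_div_cancel_left _ (by omega)
  have hVab : b * c / b = c := Nat.mul_div_cancel_left _ (by omega)
  have haV : a ≤ a * b * c := by
    calc a = a * 1 * 1 := by ring
      _ ≤ a * b * c := Nat.mul_le_mul (Nat.mul_le_mul le_rfl hb) hc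
  have hbV : b ≤ b * c := by
    calc b = b * 1 := by ring
      _ ≤ b * c := Nat.mul_le_mul le_rfl hc
  simp only [tierTriples, List.mem_flatMap, List.mem_range]
  refine ⟨a - 1, by omega, ?_⟩
  rw [Nat.sub_add_cancel ha, if_pos (by rw [mul_assoc]; exact Nat.mul_mod_right _ _), List.mem_filterMap]
  refine ⟨b - 1, ?_, ?_⟩
  · rw [List.mem_range, hVa]; omega
  · rw [Nat.sub_add_cancel hb, hVa, hVab, if_pos ⟨Nat.mul_mod_right _ _, h⟩]

/-- What the candidate enumeration guarantees about its members. -/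
theorem of_mem_tierTriples {V : ℕ} {t : ℕ × ℕ × ℕ} (ht : t ∈ tierTriples V) :
    1 ≤ t.1 ∧ 1 ≤ t.2.1 ∧ 1 ≤ t.2.2 ∧ vol t = V ∧ tableOK 127 t.1 t.2.1 t.2.2 = true := by
  simp only [tierTriples, List.mem_flatMap, List.mem_range] at ht
  obtain ⟨a', _, hx⟩ := ht
  by_cases h1 : V % (a' + 1) = 0
  · rw [if_pos h1, List.mem_filterMap] at hx
    obtain ⟨b', hb', hy⟩ := hx
    rw [List.mem_range] at hb'
    by_cases h2 : V / (a' + 1) % (b' + 1) = 0 ∧ tableOK 127 (a' + 1) (b' + 1) (V / (a' + 1) / (b' + 1)) = true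
    · rw [if_pos h2] at hy
      simp only [Option.some.injEq] at hy
      subst hy
      have hd1 : (a' + 1) * (V / (a' + 1)) = V := Nat.mul_div_cancel' (Nat.dvd_of_mod_eq_zero h1)
      have hd2 : (b' + 1) * (V / (a' + 1) / (b' + 1)) = V / (a' + 1) :=
        Nat.mul_div_cancel' (Nat.dvd_of_mod_eq_zero h2.1)
      refine ⟨by simp, by simp, ?_, ?_, h2.2⟩
      · show 1 ≤ V / (a' + 1) / (b' + 1)
        exact Nat.div_pos (by omega) (by omega)
      · show (a' + 1) * (b' + 1) * (V / (a' + 1) / (b' + 1)) = V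
        rw [mul_assoc, hd2, hd1]
    · rw [if_neg h2] at hy; exact absurd hy (by simp)
  · rw [if_neg h1] at hx; exact absurd hx (by simp)

/-- The weight of a candidate shape is an item of its volume. -/
theorem us_mem_tierUs {t : ℕ × ℕ × ℕ} (h1 : 1 ≤ t.1) (h2 : 1 ≤ t.2.1) (h3 : 1 ≤ t.2.2)
    (h : tableOK 127 t.1 t.2.1 t.2.2 = true) : us t ∈ tierUs (vol t) := by
  obtain ⟨a, b, c⟩ := t
  simp only [tierUs, List.mem_dedup, List.mem_map]
  exact ⟨(a, b, c), mem_tierTriples h1 h2 h3 h, rfl⟩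

/-- Items have positive weight. -/
theorem one_le_of_mem_tierUs {V U : ℕ} (h : U ∈ tierUs V) : 1 ≤ U := by
  simp only [tierUs, List.mem_dedup, List.mem_map] at h
  obtain ⟨t, ht, rfl⟩ := h
  obtain ⟨h1, h2, h3, -, -⟩ := of_mem_tierTriples ht
  have : 1 * 1 ≤ t.1 * t.2.1 := Nat.mul_le_mul h1 h2
  omega

/-- Inserting the items of volume `V` extends domination from `Cov (V - 1)`-like classes by the candidates of volume `V`. -/
theorem addTier_dom (V : ℕ) (row : List ℕ) (hlen : row.length = Bmax + 1) (C : ℕ × ℕ × ℕ → Prop)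
    (hdom : Dom row C) :
    (addTier V row).length = Bmax + 1 ∧ Dom (addTier V row) (fun t => C t ∨ (vol t = V ∧ us t ∈ tierUs V)) := by
  obtain ⟨hlen', hdom'⟩ := foldl_knapAdd_dom (qOf V) (tierUs V) row C (fun U h => one_le_of_mem_tierUs h) hlen hdom
  refine ⟨hlen', hdom'.mono fun t ht => ?_⟩
  rcases ht with h | ⟨hv, hu⟩
  · exact Or.inl h
  · exact Or.inr ⟨by rw [hv], hu⟩

/-- Shapes with positive sizes have positive volume. -/
theorem vol_pos {t : ℕ × ℕ × ℕ} (h1 : 1 ≤ t.1) (h2 : 1 ≤ t.2.1) (h3 : 1 ≤ t.2.2) : 1 ≤ vol t := by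
  unfold vol
  calc 1 = 1 * 1 * 1 := by norm_num
    _ ≤ t.1 * t.2.1 * t.2.2 := Nat.mul_le_mul (Nat.mul_le_mul h1 h2) h3

/-- The zero row dominates volume `0` (no candidate has volume `0`). -/
theorem dom_zero : Dom (List.replicate (Bmax + 1) 0) (Cov 0) := by
  intro G hG b hb hs
  have : G = [] := by
    rcases G with _ | ⟨t, G⟩
    · rfl
    · obtain ⟨h1, h2, h3, _, hv⟩ := hG t (List.mem_cons_self)
      have := vol_pos h1 h2 h3
      omega
  subst this
  simp

/-- The precomputed tiers: rows have full length and dominate their volume class, triples are the candidates,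
volumes are `n, n-1, …, 1`. -/
theorem rowsDesc_spec : ∀ n : ℕ,
    (headRow (rowsDesc n)).length = Bmax + 1 ∧ Dom (headRow (rowsDesc n)) (Cov n) ∧
    (∀ r ∈ rowsDesc n, r.row.length = Bmax + 1 ∧ Dom r.row (Cov r.V) ∧ r.triples = tierTriples r.V ∧
      1 ≤ r.V ∧ r.V ≤ n) ∧
    (∀ V, 1 ≤ V → V ≤ n → ∃ r ∈ rowsDesc n, r.V = V) ∧
    (rowsDesc n).Pairwise (fun r r' => r'.V < r.V)
  | 0 => by
    refine ⟨by simp [headRow, rowsDesc], by simpa [headRow, rowsDesc] using dom_zero, by simp [rowsDesc],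
      fun V h1 h2 => by omega, by simp [rowsDesc]⟩
  | n + 1 => by
    obtain ⟨hlen, hdom, hall, hex, hpw⟩ := rowsDesc_spec n
    obtain ⟨hlen', hdom'⟩ := addTier_dom (n + 1) _ hlen _ hdom
    have hdomS : Dom (addTier (n + 1) (headRow (rowsDesc n))) (Cov (n + 1)) := by
      refine hdom'.mono fun t ht => ?_
      obtain ⟨h1, h2, h3, htab, hv⟩ := ht
      rcases Nat.lt_or_ge (vol t) (n + 1) with hlt | hge
      · exact Or.inl ⟨h1, h2, h3, htab, by omega⟩
      · have hvt : vol t = n + 1 := by omega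
        exact Or.inr ⟨hvt, hvt ▸ us_mem_tierUs h1 h2 h3 htab⟩
    refine ⟨by simpa [rowsDesc, headRow] using hlen', by simpa [rowsDesc, headRow] using hdomS, ?_, ?_, ?_⟩
    · intro r hr
      simp only [rowsDesc, List.mem_cons] at hr
      rcases hr with rfl | hr
      · exact ⟨hlen', hdomS, rfl, Nat.succ_pos n, le_rfl⟩
      · obtain ⟨a1, a2, a3, a4, a5⟩ := hall r hr
        exact ⟨a1, a2, a3, a4, by omega⟩
    · intro V h1 h2
      rcases Nat.lt_or_ge V (n + 1) with hlt | hge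
      · obtain ⟨r, hr, hrV⟩ := hex V h1 (by omega)
        exact ⟨r, by simp [rowsDesc, hr], hrV⟩
      · exact ⟨⟨n + 1, addTier (n + 1) (headRow (rowsDesc n)), tierTriples (n + 1)⟩, by simp [rowsDesc],
          by show n + 1 = V; omega⟩
    · simp only [rowsDesc, List.pairwise_cons]
      exact ⟨fun r hr => by have := (hall r hr).2.2.2.2; simp; omega, hpw⟩

end Summit.MatrixMultiplication.MatrixMultiplication.Theorems.TECert
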